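import Summits.QuantumFields.YangMills.Theorems.UnitScaleTiltProp8ChartRemainderColumnLetter
import Summits.QuantumFields.YangMills.Theorems.UnitScaleTiltProp8ChartLocalityFlat
import Summits.QuantumFields.YangMills.Theorems.UnitScaleTiltProp8ChartDoubleBarDeriv
import HarnessLib

/-!
# Route `UnitScaleTilt`, crux K1 «MinimiserStabilityRegPr» (stmt-QuantumFields-19200), stub V2′ `stub_halvingStep` — pillar P3 (R1) re-base, RULING g26-№6 (S4):
# **THE (X2-C′) COLUMN LETTER FOR THE DOUBLE-BAR CHART OF RECORD FROM THE PER-BOND KERNEL (157)** (the ♭-twin of ✓p608316 `ChartRemainderColumnLetter` §2∕§5)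

Cell `ym3-torus` (HUMAN RULING D-0037: YM₃ on the torus is ladder rung R3, not the Clay problem), width seat `ym-ust-19936-w8` gen 0.
`--supports stmt-QuantumFields-19200 --as helper`; def-free, 0 sorry, standard axioms.

WHY.  RULING g26-№6 re-based the H-side chart on print's double-bar functional `chartLogFlat` (✓`Prop8ChartDoubleBar`), for which [Balaban1985Averaging] (157) — the
per-bond kernel row (X2-C′-KERNEL) `‖fderiv ℂ C♭ Y (Pi.single b M) i‖ ≤ C₃♭·ρ·η·(L^{j(i)})⁻²·‖M‖` — holds as displayed (RULING №4∕№6 numerics; (S3) types it), whereas it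
is false k-uniformly for the retired single-bar chart (✓`ChartBasePointGaugeLine`).  ✓p608316 derived the (X2-C′) COLUMN letter of ✓`DressingTransposeLetters.X2D_letter`
from that kernel row + derivative LOCALITY + the level-geometric column count; its §3 (abstract knit) and §4 (count on `BondIdx D`) are chart-agnostic and are imported;
THIS FILE re-reads §2 (locality) and §5 (assembly) for `C♭ := chartLogFlat η D − fderiv ℂ (chartLogFlat η D) 0`, using ✓`chartLogFlat_congr` (same read set) and
✓`differentiableAt_chartLogFlat_zero`.
WHAT (def-free).  §2♭ `chartLogFlat_add_single_of_not_read`, `fderiv_chartLogFlat_zero_single_of_not_read`, ★`fderiv_chartRemainderFlat_single_of_not_read`;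
§5♭ ★★`hCcolFlat_fderiv_of_kernel157` — the `hCcol` binder of `X2D_letter` ∕ FILE C `hWq_dressed_of_columnLetters` at the WEIGHT OF RECORD `u_i = η⁻³(L^{j(i)}η)⁻¹`,
`c₃ := 7·C₃♭·ρ`, from the displayed kernel row for `C♭` (locality discharged, count = ✓`hCcol_of_kernel157`).
HONEST SCOPE.  Bookkeeping; the kernel row for `chartLogFlat` ([B7] Prop 5 twin) is (S3)'s.  NOT a claim about the stub, the crux, the rung or the mass gap.

References: T. Bałaban, CMP **98** (1985) 17–51 [Balaban1985Averaging] Prop. 5 (156)–(157) p.42, (140)–(141) p.39; CMP **102** (1985) 277–309 [Balaban1985Variational]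
(20) p.281, (72)–(73) p.289, (85)–(89) p.291; CMP **96** (1984) 223–250 [Balaban1984PropagatorsII] (2.3)–(2.4) p.224.
-/

set_option autoImplicit false

noncomputable section

open scoped BigOperators Matrix.Norms.L2Operator
open Filter Topology

namespace Summit.QuantumFields.YangMills.Theorems.ChartRemainderColumnLetterFlat

open Literature.MathematicalPhysics.QuantumFieldTheory.Balaban1983to89
open B6SectADomainsV1 (Domains)
open B6SectAOperatorsV1 (BondIdx)
open B5Eq118OneStroke (iterBlockOf)
open B11Eq115Space (levOf)
open T3ContinuumYM3Torus (T3Family)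
open Summit.QuantumFields.YangMills.Theorems.FlatCubeOpsText (IsLevWeight)
open Summit.QuantumFields.YangMills.Theorems.Prop8ChartDoubleBar (chartLogFlat chartLogFlat_congr differentiableAt_chartLogFlat_zero)
open Summit.QuantumFields.YangMills.Theorems.ChartRemainderColumnLetter (fderiv_apply_eq_zero_of_const_line)

/-! ## §2♭ Derivative locality of the double-bar chart and of its remainder -/

section Locality

variable {P : Params} [DecidableEq (PBond P 0)] {𝔸 : Type*} [NormedRing 𝔸] [NormedAlgebra ℂ 𝔸] [CompleteSpace 𝔸]
/-- **A SINGLE-BOND PERTURBATION OUTSIDE THE READ SET DOES NOT CHANGE THE CHART AT THE INDEX** (`chartLogFlat_congr`): if `b` is not read by `i = (j, c)` — not both of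
`Bʲ(b₋), Bʲ(b₊)` lie in `{c₋, c₊}` — then `chartLogFlat η D (Y + e_b M) i = chartLogFlat η D Y i`. [cite: Balaban1985Averaging, Prop. 4 p.38; Balaban1985Variational, (156) p.302] -/
theorem chartLogFlat_add_single_of_not_read (η : ℝ) (D : Domains P) (Y : PBond P 0 → 𝔸) (b : PBond P 0) (M : 𝔸) (i : BondIdx D)
    (hnot : ¬ ((iterBlockOf (i.1.1 : ℕ) b.src = i.1.2.src ∨ iterBlockOf (i.1.1 : ℕ) b.src = i.1.2.tgt) ∧
      (iterBlockOf (i.1.1 : ℕ) b.tgt = i.1.2.src ∨ iterBlockOf (i.1.1 : ℕ) b.tgt = i.1.2.tgt))) :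
    chartLogFlat η D (Y + Pi.single b M) i = chartLogFlat η D Y i := by
  refine chartLogFlat_congr η D i fun b' hs ht => ?_
  rw [Pi.add_apply]
  by_cases hb : b' = b
  · subst hb; exact absurd ⟨hs, ht⟩ hnot
  · rw [Pi.single_eq_of_ne hb, add_zero]

/-- **THE LINEARISED CHART DOES NOT SEE UNREAD BONDS**: `fderiv ℂ (chartLogFlat η D) 0 (e_b M) i = 0` for `b` outside the read set of `i` (for any chart differentiable at
the flat point — `h0`; at `M_n(ℂ)` ✓`differentiableAt_chartLogFlat_zero`). [cite: Balaban1985Averaging, (140)-(141) p.39, (147) p.40] -/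
theorem fderiv_chartLogFlat_zero_single_of_not_read (η : ℝ) (D : Domains P)
    (h0 : DifferentiableAt ℂ (chartLogFlat η D : (PBond P 0 → 𝔸) → BondIdx D → 𝔸) 0) (b : PBond P 0) (M : 𝔸) (i : BondIdx D)
    (hnot : ¬ ((iterBlockOf (i.1.1 : ℕ) b.src = i.1.2.src ∨ iterBlockOf (i.1.1 : ℕ) b.src = i.1.2.tgt) ∧
      (iterBlockOf (i.1.1 : ℕ) b.tgt = i.1.2.src ∨ iterBlockOf (i.1.1 : ℕ) b.tgt = i.1.2.tgt))) :
    fderiv ℂ (chartLogFlat η D : (PBond P 0 → 𝔸) → BondIdx D → 𝔸) 0 (Pi.single b M) i = 0 := by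
  refine fderiv_apply_eq_zero_of_const_line (chartLogFlat η D : (PBond P 0 → 𝔸) → BondIdx D → 𝔸) 0 (Pi.single b M) i
    h0 fun t => ?_
  rw [show t • (Pi.single b M : PBond P 0 → 𝔸) = Pi.single b (t • M) from (Pi.single_smul' b t M).symm]
  exact chartLogFlat_add_single_of_not_read η D 0 b (t • M) i hnot

/-- ★ **DERIVATIVE LOCALITY OF THE CHART REMAINDER** `C = chartLogFlat η D − fderiv ℂ (chartLogFlat η D) 0` at ANY point `Y` where the chart is differentiable (✓ hCd on the
weighted ball): for a fine bond `b` outside the read set of the index `i`, `fderiv ℂ C Y (e_b M) i = 0` — print's *«|(δ∕δA_b)C_k(U₀, A, c)| … b ⊂ Bᵏ(c₋) ∪ Bᵏ(c₊)»*.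
[cite: Balaban1985Averaging, Prop. 5 (157) p.42; Balaban1985Variational, (72)-(73) p.289] -/
theorem fderiv_chartRemainderFlat_single_of_not_read (η : ℝ) (D : Domains P)
    (h0 : DifferentiableAt ℂ (chartLogFlat η D : (PBond P 0 → 𝔸) → BondIdx D → 𝔸) 0) {Y : PBond P 0 → 𝔸}
    (hY : DifferentiableAt ℂ (chartLogFlat η D : (PBond P 0 → 𝔸) → BondIdx D → 𝔸) Y) (b : PBond P 0) (M : 𝔸) (i : BondIdx D)
    (hnot : ¬ ((iterBlockOf (i.1.1 : ℕ) b.src = i.1.2.src ∨ iterBlockOf (i.1.1 : ℕ) b.src = i.1.2.tgt) ∧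
      (iterBlockOf (i.1.1 : ℕ) b.tgt = i.1.2.src ∨ iterBlockOf (i.1.1 : ℕ) b.tgt = i.1.2.tgt))) :
    fderiv ℂ (fun A : PBond P 0 → 𝔸 => chartLogFlat η D A - fderiv ℂ (chartLogFlat η D : (PBond P 0 → 𝔸) → BondIdx D → 𝔸) 0 A) Y (Pi.single b M) i = 0 := by
  have hdiff : DifferentiableAt ℂ (fun A : PBond P 0 → 𝔸 => chartLogFlat η D A - fderiv ℂ (chartLogFlat η D : (PBond P 0 → 𝔸) → BondIdx D → 𝔸) 0 A) Y :=
    hY.sub (fderiv ℂ (chartLogFlat η D : (PBond P 0 → 𝔸) → BondIdx D → 𝔸) 0).differentiableAt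
  refine fderiv_apply_eq_zero_of_const_line
    (fun A : PBond P 0 → 𝔸 => chartLogFlat η D A - fderiv ℂ (chartLogFlat η D : (PBond P 0 → 𝔸) → BondIdx D → 𝔸) 0 A) Y (Pi.single b M) i hdiff
    fun t => ?_
  simp only [Pi.sub_apply, map_add, map_smul, Pi.add_apply, Pi.smul_apply]
  rw [fderiv_chartLogFlat_zero_single_of_not_read η D h0 b M i hnot, smul_zero, add_zero,
    show t • (Pi.single b M : PBond P 0 → 𝔸) = Pi.single b (t • M) from (Pi.single_smul' b t M).symm,
    chartLogFlat_add_single_of_not_read η D Y b (t • M) i hnot]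

end Locality

/-! ## §5♭ The (X2-C′) letter for the double-bar chart at the cube-sequence weights -/

section T3

variable (F : T3Family) (n K : ℕ) [DecidableEq (PBond (F.P K) 0)] (D : Domains (F.P K))
/-- ★★ **(X2-C′) FROM (157) AT `C′ := fderiv ℂ C Y`**, `C = chartLogFlat η D − fderiv ℂ (chartLogFlat η D) 0` the chart remainder of record (P3 `ChartRemainderAt`): the column
letter of `DressingTransposeLetters.X2D_letter` with the derivative LOCALITY DISCHARGED (§2, at any differentiability point `Y` of the chart — ✓ hCd on the
weighted ball) and the per-bond kernel row (X2-C′-KERNEL) = [Balaban1985Averaging] (157) for `chartLogFlat` DISPLAYED ((S3)'s [B7]-Prop-5 twin; TRUE as displayed for the double-bar chart per RULING №6's numerics).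
[cite: Balaban1985Averaging, Prop. 5 (157) p.42; Balaban1985Variational, (72)-(73) p.289, (85)-(86) p.291] -/
theorem hCcolFlat_fderiv_of_kernel157 (hDk : D.k = K - n) {w : ℕ → PBond (F.P K) 0 → ℝ} (hw : IsLevWeight F n K D w)
    {Y : PBond (F.P K) 0 → Matrix (Fin 2) (Fin 2) ℂ}
    (hY : DifferentiableAt ℂ (chartLogFlat (((F.L : ℝ)⁻¹) ^ (K - n)) D :
      (PBond (F.P K) 0 → Matrix (Fin 2) (Fin 2) ℂ) → BondIdx D → Matrix (Fin 2) (Fin 2) ℂ) Y)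
    {C₃ ρ : ℝ} (hC₃ : 0 ≤ C₃) (hρ : 0 ≤ ρ)
    (hK : ∀ (b : PBond (F.P K) 0) (M : Matrix (Fin 2) (Fin 2) ℂ) (i : BondIdx D),
      ‖fderiv ℂ (fun A : PBond (F.P K) 0 → Matrix (Fin 2) (Fin 2) ℂ =>
            chartLogFlat (((F.L : ℝ)⁻¹) ^ (K - n)) D A -
              fderiv ℂ (chartLogFlat (((F.L : ℝ)⁻¹) ^ (K - n)) D :
                (PBond (F.P K) 0 → Matrix (Fin 2) (Fin 2) ℂ) → BondIdx D → Matrix (Fin 2) (Fin 2) ℂ) 0 A) Y (Pi.single b M) i‖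
        ≤ C₃ * ρ * ((F.L : ℝ)⁻¹) ^ (K - n) * (((F.L : ℝ) ^ (i.1.1 : ℕ))⁻¹) ^ 2 * ‖M‖)
    (δ : PBond (F.P K) 0 → Matrix (Fin 2) (Fin 2) ℂ) :
    ∑ i : BondIdx D, ((((F.L : ℝ)⁻¹) ^ (K - n)) ^ 3)⁻¹ * ((F.L : ℝ) ^ (i.1.1 : ℕ) * ((F.L : ℝ)⁻¹) ^ (K - n))⁻¹ *
        ‖fderiv ℂ (fun A : PBond (F.P K) 0 → Matrix (Fin 2) (Fin 2) ℂ =>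
            chartLogFlat (((F.L : ℝ)⁻¹) ^ (K - n)) D A -
              fderiv ℂ (chartLogFlat (((F.L : ℝ)⁻¹) ^ (K - n)) D :
                (PBond (F.P K) 0 → Matrix (Fin 2) (Fin 2) ℂ) → BondIdx D → Matrix (Fin 2) (Fin 2) ℂ) 0 A) Y δ i‖
      ≤ 7 * C₃ * ρ * ∑ b, (w 3 b)⁻¹ * ‖δ b‖ :=
  ChartRemainderColumnLetter.hCcol_of_kernel157 F n K D hDk hw
    (fderiv ℂ (fun A : PBond (F.P K) 0 → Matrix (Fin 2) (Fin 2) ℂ =>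
        chartLogFlat (((F.L : ℝ)⁻¹) ^ (K - n)) D A -
          fderiv ℂ (chartLogFlat (((F.L : ℝ)⁻¹) ^ (K - n)) D :
            (PBond (F.P K) 0 → Matrix (Fin 2) (Fin 2) ℂ) → BondIdx D → Matrix (Fin 2) (Fin 2) ℂ) 0 A) Y :
      (PBond (F.P K) 0 → Matrix (Fin 2) (Fin 2) ℂ) →ₗ[ℂ] (BondIdx D → Matrix (Fin 2) (Fin 2) ℂ))
    hC₃ hρ (fun b M i hnot => fderiv_chartRemainderFlat_single_of_not_read _ D (differentiableAt_chartLogFlat_zero _ D) hY b M i hnot) hK δ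


/-- ★★ **(X2-C′) FROM THE READ-BOND KERNEL ROW ONLY** (v1.1, the adapter for (S4′)'s F3d): the same column letter when the per-bond kernel bound (157)♭ is supplied
ONLY on the bonds `b` READ by the index `i = (j, c)` (both `Bʲ(b₋), Bʲ(b₊) ∈ {c₋, c₊}`) — on the unread bonds the derivative vanishes (§2♭
`fderiv_chartRemainderFlat_single_of_not_read`) and the bound's right side is nonnegative, so the full `hK` of `hCcolFlat_fderiv_of_kernel157` follows.
[cite: Balaban1985Averaging, Prop. 5 (157) p.42, Prop. 4 p.38; Balaban1985Variational, (72)-(73) p.289, (156) p.302] -/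
theorem hCcolFlat_fderiv_of_readKernel157 (hDk : D.k = K - n) {w : ℕ → PBond (F.P K) 0 → ℝ} (hw : IsLevWeight F n K D w)
    {Y : PBond (F.P K) 0 → Matrix (Fin 2) (Fin 2) ℂ}
    (hY : DifferentiableAt ℂ (chartLogFlat (((F.L : ℝ)⁻¹) ^ (K - n)) D :
      (PBond (F.P K) 0 → Matrix (Fin 2) (Fin 2) ℂ) → BondIdx D → Matrix (Fin 2) (Fin 2) ℂ) Y)
    {C₃ ρ : ℝ} (hC₃ : 0 ≤ C₃) (hρ : 0 ≤ ρ)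
    (hKread : ∀ (b : PBond (F.P K) 0) (M : Matrix (Fin 2) (Fin 2) ℂ) (i : BondIdx D),
      ((iterBlockOf (i.1.1 : ℕ) b.src = i.1.2.src ∨ iterBlockOf (i.1.1 : ℕ) b.src = i.1.2.tgt) ∧
        (iterBlockOf (i.1.1 : ℕ) b.tgt = i.1.2.src ∨ iterBlockOf (i.1.1 : ℕ) b.tgt = i.1.2.tgt)) →
      ‖fderiv ℂ (fun A : PBond (F.P K) 0 → Matrix (Fin 2) (Fin 2) ℂ =>
            chartLogFlat (((F.L : ℝ)⁻¹) ^ (K - n)) D A -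
              fderiv ℂ (chartLogFlat (((F.L : ℝ)⁻¹) ^ (K - n)) D :
                (PBond (F.P K) 0 → Matrix (Fin 2) (Fin 2) ℂ) → BondIdx D → Matrix (Fin 2) (Fin 2) ℂ) 0 A) Y (Pi.single b M) i‖
        ≤ C₃ * ρ * ((F.L : ℝ)⁻¹) ^ (K - n) * (((F.L : ℝ) ^ (i.1.1 : ℕ))⁻¹) ^ 2 * ‖M‖)
    (δ : PBond (F.P K) 0 → Matrix (Fin 2) (Fin 2) ℂ) :
    ∑ i : BondIdx D, ((((F.L : ℝ)⁻¹) ^ (K - n)) ^ 3)⁻¹ * ((F.L : ℝ) ^ (i.1.1 : ℕ) * ((F.L : ℝ)⁻¹) ^ (K - n))⁻¹ *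
        ‖fderiv ℂ (fun A : PBond (F.P K) 0 → Matrix (Fin 2) (Fin 2) ℂ =>
            chartLogFlat (((F.L : ℝ)⁻¹) ^ (K - n)) D A -
              fderiv ℂ (chartLogFlat (((F.L : ℝ)⁻¹) ^ (K - n)) D :
                (PBond (F.P K) 0 → Matrix (Fin 2) (Fin 2) ℂ) → BondIdx D → Matrix (Fin 2) (Fin 2) ℂ) 0 A) Y δ i‖
      ≤ 7 * C₃ * ρ * ∑ b, (w 3 b)⁻¹ * ‖δ b‖ := by
  refine hCcolFlat_fderiv_of_kernel157 F n K D hDk hw hY hC₃ hρ (fun b M i => ?_) δ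
  by_cases hread : (iterBlockOf (i.1.1 : ℕ) b.src = i.1.2.src ∨ iterBlockOf (i.1.1 : ℕ) b.src = i.1.2.tgt) ∧
      (iterBlockOf (i.1.1 : ℕ) b.tgt = i.1.2.src ∨ iterBlockOf (i.1.1 : ℕ) b.tgt = i.1.2.tgt)
  · exact hKread b M i hread
  · rw [fderiv_chartRemainderFlat_single_of_not_read _ D (differentiableAt_chartLogFlat_zero _ D) hY b M i hread, norm_zero]
    have hL : (0 : ℝ) ≤ (F.L : ℝ) := by positivity
    positivity


omit [DecidableEq (PBond (F.P K) 0)] in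
/-- The weighted sup-ball `{Y | ∀ b, w₁ b·‖Y b‖ < R}` is open (finite intersection of open sets). [folklore] -/
theorem isOpen_weightedBall_T3 (w₁ : PBond (F.P K) 0 → ℝ) (R : ℝ) :
    IsOpen {Y : PBond (F.P K) 0 → Matrix (Fin 2) (Fin 2) ℂ | ∀ b, w₁ b * ‖Y b‖ < R} := by
  have : {Y : PBond (F.P K) 0 → Matrix (Fin 2) (Fin 2) ℂ | ∀ b, w₁ b * ‖Y b‖ < R} =
      ⋂ b, {Y : PBond (F.P K) 0 → Matrix (Fin 2) (Fin 2) ℂ | w₁ b * ‖Y b‖ < R} := by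
    ext Y; simp
  rw [this]
  exact isOpen_iInter_of_finite fun b => isOpen_lt (continuous_const.mul (continuous_apply b).norm) continuous_const

/-- ★★ **(X2-C′) ON THE WEIGHTED BALL — THE SHAPE FILE E DISPLAYS** (v1.2, the (c3) adapter): from (a) the ♭ chart's differentiability on the weighted `w 1`-ball of radius
`R` (✓ hCd♭, `differentiableOn_chartLogFlat_weightedBall₀`) and (b) the READ-bond kernel row (157)♭ at every point `Z` of the closed `ρ′`-ball, `ρ′ < R′ ≤ R`, with the
factor `ρ′` ((S4′)'s F3d), the column letter at the weight of record holds UNIFORMLY on the ball: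
`∀ Z ρ′, ρ′ < R′ → (∀ b, w 1 b·‖Z b‖ ≤ ρ′) → ∀ δ, Σ_i η⁻³(Lʲη)⁻¹‖∂C♭(Z)[δ]_i‖ ≤ 7·C₃·ρ′·Σ_b (w 3 b)⁻¹‖δ b‖` — the `hCcol` residue of the (S6) knit verbatim.
[cite: Balaban1985Averaging, Prop. 5 (157) p.42; Balaban1985Variational, (72)-(73) p.289, (85)-(86) p.291] -/
theorem hCcolFlatBall_of_readKernel157 (hDk : D.k = K - n) {w : ℕ → PBond (F.P K) 0 → ℝ} (hw : IsLevWeight F n K D w)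
    {R R' C₃ : ℝ} (hC₃ : 0 ≤ C₃) (hR' : R' ≤ R)
    (hdiff : DifferentiableOn ℂ (chartLogFlat (((F.L : ℝ)⁻¹) ^ (K - n)) D :
      (PBond (F.P K) 0 → Matrix (Fin 2) (Fin 2) ℂ) → BondIdx D → Matrix (Fin 2) (Fin 2) ℂ) {Y | ∀ b, w 1 b * ‖Y b‖ < R})
    (hKball : ∀ (Z : PBond (F.P K) 0 → Matrix (Fin 2) (Fin 2) ℂ) (ρ' : ℝ), 0 ≤ ρ' → ρ' < R' → (∀ b, w 1 b * ‖Z b‖ ≤ ρ') →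
      ∀ (b : PBond (F.P K) 0) (M : Matrix (Fin 2) (Fin 2) ℂ) (i : BondIdx D),
      ((iterBlockOf (i.1.1 : ℕ) b.src = i.1.2.src ∨ iterBlockOf (i.1.1 : ℕ) b.src = i.1.2.tgt) ∧
        (iterBlockOf (i.1.1 : ℕ) b.tgt = i.1.2.src ∨ iterBlockOf (i.1.1 : ℕ) b.tgt = i.1.2.tgt)) →
      ‖fderiv ℂ (fun A : PBond (F.P K) 0 → Matrix (Fin 2) (Fin 2) ℂ =>
            chartLogFlat (((F.L : ℝ)⁻¹) ^ (K - n)) D A -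
              fderiv ℂ (chartLogFlat (((F.L : ℝ)⁻¹) ^ (K - n)) D :
                (PBond (F.P K) 0 → Matrix (Fin 2) (Fin 2) ℂ) → BondIdx D → Matrix (Fin 2) (Fin 2) ℂ) 0 A) Z (Pi.single b M) i‖
        ≤ C₃ * ρ' * ((F.L : ℝ)⁻¹) ^ (K - n) * (((F.L : ℝ) ^ (i.1.1 : ℕ))⁻¹) ^ 2 * ‖M‖) :
    ∀ (Z : PBond (F.P K) 0 → Matrix (Fin 2) (Fin 2) ℂ) (ρ' : ℝ), ρ' < R' → (∀ b, w 1 b * ‖Z b‖ ≤ ρ') →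
      ∀ δ : PBond (F.P K) 0 → Matrix (Fin 2) (Fin 2) ℂ,
      ∑ i : BondIdx D, ((((F.L : ℝ)⁻¹) ^ (K - n)) ^ 3)⁻¹ * ((F.L : ℝ) ^ (i.1.1 : ℕ) * ((F.L : ℝ)⁻¹) ^ (K - n))⁻¹ *
          ‖fderiv ℂ (fun A : PBond (F.P K) 0 → Matrix (Fin 2) (Fin 2) ℂ =>
              chartLogFlat (((F.L : ℝ)⁻¹) ^ (K - n)) D A -
                fderiv ℂ (chartLogFlat (((F.L : ℝ)⁻¹) ^ (K - n)) D :
                  (PBond (F.P K) 0 → Matrix (Fin 2) (Fin 2) ℂ) → BondIdx D → Matrix (Fin 2) (Fin 2) ℂ) 0 A) Z δ i‖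
        ≤ 7 * C₃ * ρ' * ∑ b, (w 3 b)⁻¹ * ‖δ b‖ := by
  intro Z ρ' hρ'R hZ δ
  -- `0 ≤ ρ′`: the weighted size of any bond variable is nonnegative
  let b₀ : PBond (F.P K) 0 := ⟨fun _ => 0, ⟨0, by rw [T3Family.P_d]; norm_num⟩⟩
  have hρ' : 0 ≤ ρ' := by
    have h0 : 0 ≤ w 1 b₀ * ‖Z b₀‖ := by
      rw [hw 1, pow_one]; exact mul_nonneg (by positivity) (norm_nonneg _)
    exact h0.trans (hZ b₀)
  -- `Z` lies in the open ball of radius `R`, where the chart is differentiable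
  have hZR : ∀ b, w 1 b * ‖Z b‖ < R := fun b => lt_of_le_of_lt (hZ b) (lt_of_lt_of_le hρ'R hR')
  have hY : DifferentiableAt ℂ (chartLogFlat (((F.L : ℝ)⁻¹) ^ (K - n)) D :
      (PBond (F.P K) 0 → Matrix (Fin 2) (Fin 2) ℂ) → BondIdx D → Matrix (Fin 2) (Fin 2) ℂ) Z :=
    hdiff.differentiableAt ((isOpen_weightedBall_T3 F K (w 1) R).mem_nhds hZR)
  exact hCcolFlat_fderiv_of_readKernel157 F n K D hDk hw hY hC₃ hρ' (fun b M i hread => hKball Z ρ' hρ' hρ'R hZ b M i hread) δ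

end T3

end Summit.QuantumFields.YangMills.Theorems.ChartRemainderColumnLetterFlat

end
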